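import Mathlib
import Summits.MatrixMultiplication.MatrixMultiplication.Theorems.SubgroupIdentityDesigns.Negative.ProjectiveLine

/-!
# Borel counting in `GL₂(𝔽_p)`: the diagonal part and `|K| ≤ p·|K ∩ T|`

Route `LevelGradedCohnUmans`, crux `SubgroupIdentityDesigns`, the `(m,k) = (2,1)` cell — shared
bookkeeping for the volume laws (`EndPlacements`, `MiddleTorus`):

* `exists_diag_part H` — the diagonal matrices of a subgroup `H` form a subgroup;
* `card_le_mul_diag_upper` / `card_le_mul_diag_lower` — if `U⁺ ≤ K ≤ B⁺` (resp. `U⁻ ≤ K ≤ B⁻`)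
  and `D` contains the diagonal part of `K`, then `|K| ≤ p·|D|`
  (`k ↦ (k₀₁/k₀₀, k·u(-k₀₁/k₀₀))` injects `K` into `𝔽_p × D`).

VALUE = bookkeeping lemmas (all `p`), NOT summit progress; the crux item
stmt-MatrixMultiplication-14079 is untouched and remains open.
-/

set_option linter.dupNamespace false

noncomputable section

open scoped BigOperators Classical

open Summit.MatrixMultiplication.MatrixMultiplication.Theorems.LieRankDesigns.Negative (GLm Mat)

namespace Summit.MatrixMultiplication.MatrixMultiplication.Theorems.SubgroupIdentityDesigns.Negative

section BorelCounting

variable {p : ℕ} [hp : Fact p.Prime]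

/-- The diagonal part of a subgroup, as a subgroup. -/
theorem exists_diag_part (H : Subgroup (GLm p 2)) :
    ∃ D : Subgroup (GLm p 2), D ≤ H ∧ (∀ d ∈ D, (d : Mat p 2) 0 1 = 0 ∧ (d : Mat p 2) 1 0 = 0) ∧
      ∀ h ∈ H, (h : Mat p 2) 0 1 = 0 → (h : Mat p 2) 1 0 = 0 → h ∈ D := by
  obtain ⟨S', hS'le, hs', hS'B⟩ := exists_upper_part H
  refine ⟨{ carrier := {d | d ∈ S' ∧ (d : Mat p 2) 0 1 = 0},
            mul_mem' := ?_, one_mem' := ?_, inv_mem' := ?_ }, ?_, ?_, ?_⟩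
  · rintro a b ⟨ha, ha0⟩ ⟨hb, hb0⟩
    refine ⟨S'.mul_mem ha hb, ?_⟩
    simp [Units.val_mul, Matrix.mul_apply, Fin.sum_univ_two, ha0, hb0]
  · exact ⟨S'.one_mem, by simp⟩
  · rintro a ⟨ha, ha0⟩
    refine ⟨S'.inv_mem ha, ?_⟩
    rw [coe_inv_of_diag (x₀ := (a : Mat p 2) 0 0) (x₁ := (a : Mat p 2) 1 1)
      (by rw [Matrix.eta_fin_two (a : Mat p 2)]; simp [ha0, hs' a ha])]
    simp
  · exact fun d hd => hS'le hd.1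
  · exact fun d hd => ⟨hd.2, hs' d hd.1⟩
  · exact fun h hh h01 h10 => ⟨hS'B h hh h10, h01⟩

/-- **Borel counting (upper).**  If `K ≤ B⁺` contains `U⁺` and `D` contains the diagonal part of
`K`, then `|K| ≤ p·|D|`
(`k ↦ (k₀₁/k₀₀, k·u(-k₀₁/k₀₀))` is injective into `𝔽_p × D`). -/
theorem card_le_mul_diag_upper {K D : Subgroup (GLm p 2)} (hB : ∀ k ∈ K, (k : Mat p 2) 1 0 = 0)
    (hU : ∀ u : GLm p 2, (u : Mat p 2) 1 0 = 0 → (u : Mat p 2) 0 0 = 1 → (u : Mat p 2) 1 1 = 1 →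
      u ∈ K)
    (hD : ∀ k ∈ K, (k : Mat p 2) 0 1 = 0 → (k : Mat p 2) 1 0 = 0 → k ∈ D) :
    Nat.card K ≤ p * Nat.card D := by
  have hdet : ∀ s : ZMod p, Matrix.det !![(1 : ZMod p), s; 0, 1] ≠ 0 := by
    intro s; simp [Matrix.det_fin_two_of]
  let uu : ZMod p → GLm p 2 := fun s => Matrix.GeneralLinearGroup.mkOfDetNeZero _ (hdet s)
  have huu : ∀ s, ((uu s : GLm p 2) : Mat p 2) = !![1, s; 0, 1] := fun s => rfl
  let τ : GLm p 2 → ZMod p := fun k => ((k : Mat p 2) 0 0)⁻¹ * (k : Mat p 2) 0 1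
  have hent : ∀ k : GLm p 2, (k : Mat p 2) 1 0 = 0 →
      ((k * uu (-τ k) : GLm p 2) : Mat p 2) 0 1 = 0 ∧
        ((k * uu (-τ k) : GLm p 2) : Mat p 2) 1 0 = 0 := by
    intro k hk
    have hk00 : (k : Mat p 2) 0 0 ≠ 0 := (diag_ne_zero_of_upper hk).1
    constructor
    · have e : ((k * uu (-τ k) : GLm p 2) : Mat p 2) 0 1 =
          (k : Mat p 2) 0 0 * -(((k : Mat p 2) 0 0)⁻¹ * (k : Mat p 2) 0 1) + (k : Mat p 2) 0 1 := by
        simp [Units.val_mul, huu, Matrix.mul_apply, Fin.sum_univ_two, τ]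
      rw [e, mul_neg, mul_inv_cancel_left₀ hk00, neg_add_cancel]
    · simp [Units.val_mul, huu, Matrix.mul_apply, Fin.sum_univ_two, hk]
  have hmem : ∀ k : K, ((k : GLm p 2) * uu (-τ k)) ∈ D := fun k =>
    hD _ (K.mul_mem k.2 (hU _ (by simp [huu]) (by simp [huu]) (by simp [huu])))
      (hent k (hB _ k.2)).1 (hent k (hB _ k.2)).2
  let g : K → ZMod p × D := fun k => (τ k, ⟨_, hmem k⟩)
  have hinj : Function.Injective g := by
    intro k k' hkk
    simp only [g, Prod.mk.injEq, Subtype.mk.injEq] at hkk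
    obtain ⟨h1, h2⟩ := hkk
    rw [h1] at h2
    exact Subtype.ext (mul_right_cancel h2)
  have hcard := Nat.card_le_card_of_injective g hinj
  rwa [Nat.card_prod, Nat.card_eq_fintype_card (α := ZMod p), ZMod.card] at hcard

/-- **Borel counting (lower).**  If `K ≤ B⁻` contains `U⁻` and `D` contains the diagonal part of
`K`, then `|K| ≤ p·|D|`. -/
theorem card_le_mul_diag_lower {K D : Subgroup (GLm p 2)} (hB : ∀ k ∈ K, (k : Mat p 2) 0 1 = 0)
    (hL : ∀ u : GLm p 2, (u : Mat p 2) 0 1 = 0 → (u : Mat p 2) 0 0 = 1 → (u : Mat p 2) 1 1 = 1 →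
      u ∈ K)
    (hD : ∀ k ∈ K, (k : Mat p 2) 0 1 = 0 → (k : Mat p 2) 1 0 = 0 → k ∈ D) :
    Nat.card K ≤ p * Nat.card D := by
  have hdet : ∀ s : ZMod p, Matrix.det !![(1 : ZMod p), 0; s, 1] ≠ 0 := by
    intro s; simp [Matrix.det_fin_two_of]
  let uu : ZMod p → GLm p 2 := fun s => Matrix.GeneralLinearGroup.mkOfDetNeZero _ (hdet s)
  have huu : ∀ s, ((uu s : GLm p 2) : Mat p 2) = !![1, 0; s, 1] := fun s => rfl
  let τ : GLm p 2 → ZMod p := fun k => ((k : Mat p 2) 1 1)⁻¹ * (k : Mat p 2) 1 0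
  have hent : ∀ k : GLm p 2, (k : Mat p 2) 0 1 = 0 →
      ((k * uu (-τ k) : GLm p 2) : Mat p 2) 0 1 = 0 ∧
        ((k * uu (-τ k) : GLm p 2) : Mat p 2) 1 0 = 0 := by
    intro k hk
    have hk11 : (k : Mat p 2) 1 1 ≠ 0 := (diag_ne_zero_of_lower hk).2
    constructor
    · simp [Units.val_mul, huu, Matrix.mul_apply, Fin.sum_univ_two, hk]
    · have e : ((k * uu (-τ k) : GLm p 2) : Mat p 2) 1 0 =
          (k : Mat p 2) 1 0 + (k : Mat p 2) 1 1 * -(((k : Mat p 2) 1 1)⁻¹ * (k : Mat p 2) 1 0) := by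
        simp [Units.val_mul, huu, Matrix.mul_apply, Fin.sum_univ_two, τ]
      rw [e, mul_neg, mul_inv_cancel_left₀ hk11, add_neg_cancel]
  have hmem : ∀ k : K, ((k : GLm p 2) * uu (-τ k)) ∈ D := fun k =>
    hD _ (K.mul_mem k.2 (hL _ (by simp [huu]) (by simp [huu]) (by simp [huu])))
      (hent k (hB _ k.2)).1 (hent k (hB _ k.2)).2
  let g : K → ZMod p × D := fun k => (τ k, ⟨_, hmem k⟩)
  have hinj : Function.Injective g := by
    intro k k' hkk
    simp only [g, Prod.mk.injEq, Subtype.mk.injEq] at hkk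
    obtain ⟨h1, h2⟩ := hkk
    rw [h1] at h2
    exact Subtype.ext (mul_right_cancel h2)
  have hcard := Nat.card_le_card_of_injective g hinj
  rwa [Nat.card_prod, Nat.card_eq_fintype_card (α := ZMod p), ZMod.card] at hcard

end BorelCounting

end Summit.MatrixMultiplication.MatrixMultiplication.Theorems.SubgroupIdentityDesigns.Negative

end
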